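import Summits.NavierStokesRegularity.NavierStokesRegularity.Theorems.FrequencyRigidity.Negative.TwoEndedPinningStubs

/-!
# Crux `FrequencyRigidity` (stmt-NavierStokesRegularity-2955), line `two-ended-pinning`:
# Stub 3 (`stub_flatEnstrophyLiouville`) — the CRITICAL-STRAIN FLOOR of a flat inhabitant

Helper file (`--supports stmt-NavierStokesRegularity-2955`; theorems only; lead c1 of the line).
Stub 3 of the picked line forbids a FLAT INHABITANT
(`Theorems.FrequencyRigidity.Negative.TwoEndedPinning.IsFlatInhabitant ν C A C' v q K`, the landed
verbatim copy of the skeleton's predicate): a classical ancient Navier–Stokes flow on `ℝ³ × (−∞,0)`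
with the global time-Type-I bound, the scale-invariant derivative bounds, an adapted two-sided
Gaussian-comparable backward kernel `K` at `(0,0)`, the EXACT self-similar enstrophy law
`H(t) = ∫ ‖curl v(t)‖² K(t) = A(−t)^{−2}`, `A > 0` (clause (viii)), and the transport-free first
variation `H′(t) = ∫ 2(⟪ω, Dv ω⟫ − ν|∇ω|²_F) K(t)` (clause (ix)).

This file records the first NECESSARY CONDITION on a flat inhabitant that uses the Navier–Stokes
dynamics (through (ix), i.e. the vorticity equation) rather than kinematics:

* `integral_firstVariationDensity_eq_of_isFlatInhabitant` — (viii) + (ix) + uniqueness of the derivative: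
  `∫ 2(⟪ω, Dv ω⟫ − ν|∇ω|²_F) K(t) = 2A(−t)^{−3}` at EVERY `t < 0` (the instantaneous budget).
* **`stub_flatEnstrophyLiouville_strainFloor`** (registered sub-goal of Stub 3) — THE FLOOR: if at some
  `t < 0` the stretching rate in the vorticity direction is bounded by `M`,
  `⟪ω, Dv ω⟫ ≤ M‖ω‖²` for all `x`, then `M ≥ 1/(−t)`.  Proof: drop the dissipation (`ν > 0`,
  `|∇ω|²_F ≥ 0`), so `2A(−t)^{−3} ≤ 2M ∫‖ω‖²K = 2M·A(−t)^{−2}`, and divide by `2A(−t)^{−2} > 0`.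
  So a flat inhabitant STRETCHES ITS VORTICITY AT NO LESS THAN THE CRITICAL RATE `1/(−t)` somewhere,
  at every instant; the disprover's exact linear strain–rotation near-miss (`Negative/LinearStrainFlow`,
  axial stretching exactly `1/(−t)`, `∇ω = 0`) is extremal for this inequality.
* `inv_neg_le_of_norm_fderiv_le_of_isFlatInhabitant` — in particular `sup_x ‖Dv(t,x)‖ ≥ 1/(−t)`;
* `one_le_scaleInvariantConst_one_of_isFlatInhabitant` — hence the scale-invariant gradient constant obeys
  `C'₁ ≥ 1`: there is NO flat inhabitant with SUBCRITICAL strain (`C'₁ < 1`), whatever `C`, `ν`, `A`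
  (`not_isFlatInhabitant_of_scaleInvariantConst_one_lt_one`) — a mildness-free "no small witness"
  statement complementing the Duhamel gap `C < ε₀√ν` of the Disproof (which needs the mild class);
* `not_isFlatInhabitant_of_stretching_nonpos` — and NO flat inhabitant whose vortex stretching is
  non-positive at some instant (`⟪ω, Dv ω⟫ ≤ 0` for all `x` at one `t < 0`); e.g. planar / 2D flows
  (`ω ⊥` the plane of motion, `⟪ω, Dv ω⟫ = 0`) are excluded without any 2D Liouville theorem.

Nothing here closes Stub 3 (the bounded-profile rotated-self-similar Liouville problem it contains,
`Negative/RSSWall.lean`, is untouched: RSS profiles stretch at the critical rate); these are the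
instantaneous constraints every future attack may assume.

## References

* T.-P. Tsai, Arch. Ration. Mech. Anal. 143 (1998) 29–51 (self-similar enstrophy law). [Tsai1998]
* G. Koch, N. Nadirashvili, G. Seregin, V. Šverák, Acta Math. 203 (2009) 83–105, §4. [KochNadirashviliSereginSverak2009]
-/

noncomputable section

-- the summit-side namespace `Summit.NavierStokesRegularity.NavierStokesRegularity.…` repeats a component by design (D-0017)
set_option linter.dupNamespace false

namespace Summit.NavierStokesRegularity.NavierStokesRegularity.Theorems.FrequencyRigidity.TwoEndedPinning

open Literature.Analysis.FluidPDE MeasureTheory Set Filter Topology Function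
open scoped RealInnerProductSpace Laplacian ContDiff
open Summit.NavierStokesRegularity.NavierStokesRegularity.Theorems.FrequencyRigidity.Negative.TwoEndedPinning
  (IsFlatInhabitant firstVariationDensity ScaleInvariantBounds)

/-! ### The flat law differentiated -/

/-- The flat law `s ↦ A(−s)^{−2}` has derivative `2A(−t)^{−3}` at every `t < 0`. [folklore] -/
theorem hasDerivAt_flatLaw (A : ℝ) {t : ℝ} (ht : t < 0) :
    HasDerivAt (fun s : ℝ => A * (-s) ^ (-(2 : ℝ))) (2 * A * (-t) ^ (-(3 : ℝ))) t := by
  have hneg : HasDerivAt (fun s : ℝ => -s) (-1) t := (hasDerivAt_id t).neg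
  have hne : (fun s : ℝ => -s) t ≠ 0 := by simp only [ne_eq, neg_eq_zero]; exact ht.ne
  have hpow := hneg.rpow_const (p := -(2 : ℝ)) (Or.inl hne)
  have h := hpow.const_mul A
  refine h.congr_deriv ?_
  rw [show (-(2 : ℝ)) - 1 = -(3 : ℝ) by norm_num]
  ring

/-- A flat inhabitant's adapted enstrophy agrees with the flat law near every `t < 0`. [folklore] -/
theorem adaptedEnstrophy_eventuallyEq_of_isFlatInhabitant {ν C A : ℝ} {C' : ℕ → ℝ}
    {v : ℝ → EuclideanSpace ℝ (Fin 3) → EuclideanSpace ℝ (Fin 3)}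
    {q : ℝ → EuclideanSpace ℝ (Fin 3) → ℝ} {K : ℝ → EuclideanSpace ℝ (Fin 3) → ℝ}
    (h : IsFlatInhabitant ν C A C' v q K) {t : ℝ} (ht : t < 0) :
    adaptedEnstrophy v K =ᶠ[𝓝 t] fun s => A * (-s) ^ (-(2 : ℝ)) := by
  have hflat := h.2.2.2.2.2.2.2.1
  filter_upwards [isOpen_Iio.mem_nhds ht] with s hs
  exact hflat s hs

/-- **The instantaneous budget.**  For a flat inhabitant, at every `t < 0`,
`∫ 2(⟪ω, Dv ω⟫ − ν|∇ω|²_F) K(t) = 2A(−t)^{−3}`: clause (ix) says the left side is `H′(t)`,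
clause (viii) says `H(s) = A(−s)^{−2}` for all `s < 0`, and derivatives are unique. [folklore] -/
theorem integral_firstVariationDensity_eq_of_isFlatInhabitant {ν C A : ℝ} {C' : ℕ → ℝ}
    {v : ℝ → EuclideanSpace ℝ (Fin 3) → EuclideanSpace ℝ (Fin 3)}
    {q : ℝ → EuclideanSpace ℝ (Fin 3) → ℝ} {K : ℝ → EuclideanSpace ℝ (Fin 3) → ℝ}
    (h : IsFlatInhabitant ν C A C' v q K) {t : ℝ} (ht : t < 0) :
    ∫ x, firstVariationDensity ν v t x * K t x = 2 * A * (-t) ^ (-(3 : ℝ)) := by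
  have h1 : HasDerivAt (adaptedEnstrophy v K) (∫ x, firstVariationDensity ν v t x * K t x) t :=
    h.2.2.2.2.2.2.2.2 t ht
  have h2 : HasDerivAt (adaptedEnstrophy v K) (2 * A * (-t) ^ (-(3 : ℝ))) t :=
    (hasDerivAt_flatLaw A ht).congr_of_eventuallyEq (adaptedEnstrophy_eventuallyEq_of_isFlatInhabitant h ht)
  exact h1.unique h2

/-- The instantaneous budget is POSITIVE: `∫ 2(⟪ω, Dv ω⟫ − ν|∇ω|²_F) K(t) = 2A(−t)^{−3} > 0`. [folklore] -/
theorem integral_firstVariationDensity_pos_of_isFlatInhabitant {ν C A : ℝ} {C' : ℕ → ℝ}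
    {v : ℝ → EuclideanSpace ℝ (Fin 3) → EuclideanSpace ℝ (Fin 3)}
    {q : ℝ → EuclideanSpace ℝ (Fin 3) → ℝ} {K : ℝ → EuclideanSpace ℝ (Fin 3) → ℝ}
    (h : IsFlatInhabitant ν C A C' v q K) {t : ℝ} (ht : t < 0) :
    0 < ∫ x, firstVariationDensity ν v t x * K t x := by
  rw [integral_firstVariationDensity_eq_of_isFlatInhabitant h ht]
  have hA : 0 < A := h.2.2.2.2.2.2.1
  have hp : 0 < (-t) ^ (-(3 : ℝ)) := Real.rpow_pos_of_pos (by linarith) _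
  positivity

/-- Hence the first-variation density times the kernel is (Bochner-)integrable at every `t < 0`
(a non-integrable integrand would have junk integral `0`). [folklore] -/
theorem integrable_firstVariationDensity_mul_of_isFlatInhabitant {ν C A : ℝ} {C' : ℕ → ℝ}
    {v : ℝ → EuclideanSpace ℝ (Fin 3) → EuclideanSpace ℝ (Fin 3)}
    {q : ℝ → EuclideanSpace ℝ (Fin 3) → ℝ} {K : ℝ → EuclideanSpace ℝ (Fin 3) → ℝ}
    (h : IsFlatInhabitant ν C A C' v q K) {t : ℝ} (ht : t < 0) :
    Integrable fun x => firstVariationDensity ν v t x * K t x := by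
  by_contra hni
  have h0 := integral_undef hni
  have hpos := integral_firstVariationDensity_pos_of_isFlatInhabitant h ht
  rw [h0] at hpos
  exact lt_irrefl _ hpos

/-- The enstrophy density times the kernel is integrable at every `t < 0` (its integral is
`A(−t)^{−2} ≠ 0`). [folklore] -/
theorem integrable_normCurlSq_mul_of_isFlatInhabitant {ν C A : ℝ} {C' : ℕ → ℝ}
    {v : ℝ → EuclideanSpace ℝ (Fin 3) → EuclideanSpace ℝ (Fin 3)}
    {q : ℝ → EuclideanSpace ℝ (Fin 3) → ℝ} {K : ℝ → EuclideanSpace ℝ (Fin 3) → ℝ}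
    (h : IsFlatInhabitant ν C A C' v q K) {t : ℝ} (ht : t < 0) :
    Integrable fun x => ‖curl (v t) x‖ ^ 2 * K t x := by
  by_contra hni
  have h0 : adaptedEnstrophy v K t = 0 := by
    rw [adaptedEnstrophy_apply]
    exact integral_undef hni
  have hflat : adaptedEnstrophy v K t = A * (-t) ^ (-(2 : ℝ)) := h.2.2.2.2.2.2.2.1 t ht
  have hA : 0 < A := h.2.2.2.2.2.2.1
  have hp : 0 < (-t) ^ (-(2 : ℝ)) := Real.rpow_pos_of_pos (by linarith) _
  have : (0 : ℝ) < 0 := by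
    calc (0 : ℝ) < A * (-t) ^ (-(2 : ℝ)) := mul_pos hA hp
      _ = 0 := by rw [← hflat, h0]
  exact lt_irrefl _ this

/-! ### The floor -/

/-- **Registered sub-goal `stub_flatEnstrophyLiouville_strainFloor` of Stub 3 of line
`two-ended-pinning` — THE CRITICAL-STRAIN FLOOR.**  If `(ν, C, A, C', v, q, K)` is a flat inhabitant
and at some `t < 0` the vortex-stretching rate in the vorticity direction is bounded above by `M`,
`⟪ω, Dv ω⟫ ≤ M ‖ω‖²` on `ℝ³` (`ω = curl v(t)`), then `M ≥ 1/(−t)`.  Proof: by the instantaneous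
budget `2A(−t)^{−3} = ∫ 2(⟪ω, Dv ω⟫ − ν|∇ω|²_F)K ≤ ∫ 2M‖ω‖²K = 2M·A(−t)^{−2}` (`ν > 0`,
`|∇ω|²_F ≥ 0`, `K > 0`), and `2A(−t)^{−2} > 0`. [folklore] -/
theorem stub_flatEnstrophyLiouville_strainFloor :
    ∀ (ν C A : ℝ) (C' : ℕ → ℝ) (v : ℝ → EuclideanSpace ℝ (Fin 3) → EuclideanSpace ℝ (Fin 3))
      (q : ℝ → EuclideanSpace ℝ (Fin 3) → ℝ) (K : ℝ → EuclideanSpace ℝ (Fin 3) → ℝ),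
      Summit.NavierStokesRegularity.NavierStokesRegularity.Theorems.FrequencyRigidity.Negative.TwoEndedPinning.IsFlatInhabitant
          ν C A C' v q K →
        ∀ t : ℝ, t < 0 → ∀ M : ℝ,
          (∀ x : EuclideanSpace ℝ (Fin 3),
              inner ℝ (Literature.Analysis.FluidPDE.curl (v t) x)
                  (fderiv ℝ (v t) x (Literature.Analysis.FluidPDE.curl (v t) x)) ≤
                M * ‖Literature.Analysis.FluidPDE.curl (v t) x‖ ^ 2) →
          (-t)⁻¹ ≤ M := by
  intro ν C A C' v q K h t ht M hM
  have hν : 0 < ν := h.1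
  have hK : IsAdaptedBackwardKernel ν v (Iio 0) 0 0 K := h.2.2.2.2.1
  have hA : 0 < A := h.2.2.2.2.2.2.1
  have hflat : adaptedEnstrophy v K t = A * (-t) ^ (-(2 : ℝ)) := h.2.2.2.2.2.2.2.1 t ht
  have hnt : 0 < -t := by linarith
  have ht' : t ∈ Iio (0 : ℝ) := ht
  -- the budget and the two integrable densities
  have hI := integral_firstVariationDensity_eq_of_isFlatInhabitant h ht
  have hint₁ := integrable_firstVariationDensity_mul_of_isFlatInhabitant h ht
  have hint₂ : Integrable fun x => 2 * M * (‖curl (v t) x‖ ^ 2 * K t x) :=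
    (integrable_normCurlSq_mul_of_isFlatInhabitant h ht).const_mul (2 * M)
  -- pointwise: drop the dissipation, bound the stretching
  have hpt : ∀ x, firstVariationDensity ν v t x * K t x ≤ 2 * M * (‖curl (v t) x‖ ^ 2 * K t x) := by
    intro x
    have hKx : 0 ≤ K t x := (hK.pos t ht' x).le
    have hfr : 0 ≤ ν * frobeniusNormSq (fderiv ℝ (curl (v t)) x) :=
      mul_nonneg hν.le (frobeniusNormSq_nonneg _)
    have h1 : firstVariationDensity ν v t x ≤ 2 * M * ‖curl (v t) x‖ ^ 2 := by
      simp only [firstVariationDensity]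
      nlinarith [hM x, hfr]
    calc firstVariationDensity ν v t x * K t x ≤ 2 * M * ‖curl (v t) x‖ ^ 2 * K t x :=
          mul_le_mul_of_nonneg_right h1 hKx
      _ = 2 * M * (‖curl (v t) x‖ ^ 2 * K t x) := by ring
  -- integrate
  have hle : 2 * A * (-t) ^ (-(3 : ℝ)) ≤ 2 * M * (A * (-t) ^ (-(2 : ℝ))) := by
    calc 2 * A * (-t) ^ (-(3 : ℝ)) = ∫ x, firstVariationDensity ν v t x * K t x := hI.symm
      _ ≤ ∫ x, 2 * M * (‖curl (v t) x‖ ^ 2 * K t x) := integral_mono hint₁ hint₂ hpt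
      _ = 2 * M * ∫ x, ‖curl (v t) x‖ ^ 2 * K t x := integral_const_mul _ _
      _ = 2 * M * (A * (-t) ^ (-(2 : ℝ))) := by rw [← adaptedEnstrophy_apply, hflat]
  -- divide by `2A(−t)^{−2} > 0`
  have e3 : (-t) ^ (-(3 : ℝ)) = (-t) ^ (-(2 : ℝ)) * (-t)⁻¹ := by
    rw [← Real.rpow_neg_one, ← Real.rpow_add hnt]
    norm_num
  have hc : 0 < 2 * A * (-t) ^ (-(2 : ℝ)) := by
    have hp : 0 < (-t) ^ (-(2 : ℝ)) := Real.rpow_pos_of_pos hnt _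
    positivity
  have hmul : 2 * A * (-t) ^ (-(2 : ℝ)) * (-t)⁻¹ ≤ 2 * A * (-t) ^ (-(2 : ℝ)) * M := by
    calc 2 * A * (-t) ^ (-(2 : ℝ)) * (-t)⁻¹ = 2 * A * (-t) ^ (-(3 : ℝ)) := by rw [e3]; ring
      _ ≤ 2 * M * (A * (-t) ^ (-(2 : ℝ))) := hle
      _ = 2 * A * (-t) ^ (-(2 : ℝ)) * M := by ring
  exact le_of_mul_le_mul_left hmul hc

/-! ### Consequences -/

/-- **`sup_x ‖Dv(t,x)‖ ≥ 1/(−t)`.**  If the velocity gradient of a flat inhabitant is bounded in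
operator norm by `M` at some `t < 0`, then `M ≥ 1/(−t)` (`⟪ω, Dv ω⟫ ≤ ‖Dv‖ ‖ω‖²`). [folklore] -/
theorem inv_neg_le_of_norm_fderiv_le_of_isFlatInhabitant {ν C A : ℝ} {C' : ℕ → ℝ}
    {v : ℝ → EuclideanSpace ℝ (Fin 3) → EuclideanSpace ℝ (Fin 3)}
    {q : ℝ → EuclideanSpace ℝ (Fin 3) → ℝ} {K : ℝ → EuclideanSpace ℝ (Fin 3) → ℝ}
    (h : IsFlatInhabitant ν C A C' v q K) {t : ℝ} (ht : t < 0) {M : ℝ}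
    (hM : ∀ x, ‖fderiv ℝ (v t) x‖ ≤ M) : (-t)⁻¹ ≤ M := by
  refine stub_flatEnstrophyLiouville_strainFloor ν C A C' v q K h t ht M fun x => ?_
  set w := curl (v t) x with hw
  calc ⟪w, fderiv ℝ (v t) x w⟫ ≤ ‖w‖ * ‖fderiv ℝ (v t) x w‖ := real_inner_le_norm _ _
    _ ≤ ‖w‖ * (‖fderiv ℝ (v t) x‖ * ‖w‖) :=
        mul_le_mul_of_nonneg_left (ContinuousLinearMap.le_opNorm _ _) (norm_nonneg _)
    _ ≤ ‖w‖ * (M * ‖w‖) :=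
        mul_le_mul_of_nonneg_left (mul_le_mul_of_nonneg_right (hM x) (norm_nonneg _))
          (norm_nonneg _)
    _ = M * ‖w‖ ^ 2 := by ring

/-- **`C'₁ ≥ 1`.**  The first scale-invariant constant of a flat inhabitant is at least `1`: at
`t = −1` clause (iv) with `k = 1` reads `‖Dv(−1, x)‖ ≤ C'₁`, and the floor gives `1 ≤ C'₁`. [folklore] -/
theorem one_le_scaleInvariantConst_one_of_isFlatInhabitant {ν C A : ℝ} {C' : ℕ → ℝ}
    {v : ℝ → EuclideanSpace ℝ (Fin 3) → EuclideanSpace ℝ (Fin 3)}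
    {q : ℝ → EuclideanSpace ℝ (Fin 3) → ℝ} {K : ℝ → EuclideanSpace ℝ (Fin 3) → ℝ}
    (h : IsFlatInhabitant ν C A C' v q K) : 1 ≤ C' 1 := by
  have hB : ScaleInvariantBounds C' v := h.2.2.2.1
  have hM : ∀ x, ‖fderiv ℝ (v (-1)) x‖ ≤ C' 1 := by
    intro x
    have h1 := hB 1 le_rfl (-1) (by norm_num) x
    rw [norm_iteratedFDeriv_one] at h1
    norm_num at h1
    exact h1
  have := inv_neg_le_of_norm_fderiv_le_of_isFlatInhabitant h (by norm_num : (-1 : ℝ) < 0) hM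
  norm_num at this
  exact this

/-- **No flat inhabitant with subcritical strain** (`C'₁ < 1`), for any `ν`, `C`, `A`. [folklore] -/
theorem not_isFlatInhabitant_of_scaleInvariantConst_one_lt_one {ν C A : ℝ} {C' : ℕ → ℝ}
    {v : ℝ → EuclideanSpace ℝ (Fin 3) → EuclideanSpace ℝ (Fin 3)}
    {q : ℝ → EuclideanSpace ℝ (Fin 3) → ℝ} {K : ℝ → EuclideanSpace ℝ (Fin 3) → ℝ}
    (hC' : C' 1 < 1) : ¬ IsFlatInhabitant ν C A C' v q K :=
  fun h => not_le.2 hC' (one_le_scaleInvariantConst_one_of_isFlatInhabitant h)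

/-- **No flat inhabitant without vortex stretching at some instant**: if `⟪ω, Dv ω⟫ ≤ 0` on `ℝ³`
at one `t < 0` (e.g. a planar flow, `ω ⊥ Dv ω`), there is no flat inhabitant (`M = 0 < 1/(−t)`). [folklore] -/
theorem not_isFlatInhabitant_of_stretching_nonpos {ν C A : ℝ} {C' : ℕ → ℝ}
    {v : ℝ → EuclideanSpace ℝ (Fin 3) → EuclideanSpace ℝ (Fin 3)}
    {q : ℝ → EuclideanSpace ℝ (Fin 3) → ℝ} {K : ℝ → EuclideanSpace ℝ (Fin 3) → ℝ}
    {t : ℝ} (ht : t < 0)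
    (h0 : ∀ x, ⟪curl (v t) x, fderiv ℝ (v t) x (curl (v t) x)⟫ ≤ 0) :
    ¬ IsFlatInhabitant ν C A C' v q K := by
  intro h
  have hle := stub_flatEnstrophyLiouville_strainFloor ν C A C' v q K h t ht 0
    fun x => by simpa using h0 x
  have hpos : 0 < (-t)⁻¹ := inv_pos.2 (by linarith)
  linarith

end Summit.NavierStokesRegularity.NavierStokesRegularity.Theorems.FrequencyRigidity.TwoEndedPinning

end
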